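import Summits.Ventures.HSemireg.WedgeHankelRecurrenceGaussQuasiOrthogonalResultant

/-!
# Venture HSemireg — **HOMOGENEITY AND TRANSLATION INVARIANCE OF THE DISCRIMINANT ALONG THE AFFINE FAMILY OF A RECURRENCE** (N286 `recurrence_scale_spec` ∕ `recurrence_translate_spec`):
# for nodes `x_0, …, x_t`, **`disc ∏(X − (x_k + s)) = disc ∏(X − x_k)`** and **`disc ∏(X − c x_k) = c^{t(t+1)} disc ∏(X − x_k)`**; hence for a positive recurrence the translated family
# `(a + s, b)` has the same discriminants and the scaled family `(c a, c² b)` has `disc = c^{t(t+1)} disc(q_{t+1})` — consistent with N422's bound, whose right side scales by `c^{t(t+1)}` too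
# (`∏ (c² b_{j+1})^{t−j} = c^{t(t+1)} ∏ b_{j+1}^{t−j}`)

HONEST FRAMING. Part of the Lean index of the computation cell `pub-hsemireg` (seat p10 gen 47, Sunday typer «UNIFORM-IN-n»).  Polynomial algebra ∕ finite products only; no variety, no cohomology
theory, no sheaf, no Ext group and no semiregularity map is constructed here; nothing here says that HC / HC_CM / HC_AV holds; no Literature fact (unproved `Prop`) is declared or used.  Custodian
versions as in `WedgeHankelSiegelIdeal` (1/3).
SOURCES (cited).  G. Szegő, *Orthogonal Polynomials*, (6.71.1) (`D(f) = a^{2n−2} ∏_{i<j}(x_i − x_j)²`: homogeneity), §2.3 (affine changes of the variable); I. Schur 1931 §1.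
PROOF TYPED HERE.  N653-block `discr_prod_X_sub_C` and `∏_{i<j} (c x_j − c x_i) = c^{#pairs} ∏ (x_j − x_i)` with `#pairs = Σ_i (t − i) = t(t+1)∕2` (`Fin.card_Ioi`, `Finset.sum_range_id_mul_two`);
N286 for the factorisations of the scaled ∕ translated families.
DEDUP DISCLOSURE (`rg -n -i 'discr_scale|discr_translate|discr_comp' Summits/Ventures/HSemireg`, 2026-09-04): nothing; 0 hits for the 5 names below.

WHAT IS IN THE TREE.  N653-block `discr_prod_X_sub_C`; N286 `recurrence_scale_spec`, `recurrence_translate_spec`; Mathlib `Fin.card_Ioi`, `Finset.prod_pow_eq_pow_sum`, `Finset.sum_range_id_mul_two`.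
THIS FILE (namespace `Summit.Ventures.HSemireg.Wedge.HankelOuter` continued; CHAINED on N425 (import only); 0 definitions):
* §1191 `discr_nodes_translate` (`disc ∏(X − (x_k + s)) = disc ∏(X − x_k)`), `sum_card_Ioi_fin` (`Σ_i #Ioi(i) = t(t+1)∕2` on `Fin (t+1)`), **`discr_nodes_scale`** (`disc ∏(X − c x_k) = c^{t(t+1)} disc ∏(X − x_k)`),
  **`recurrence_discr_translate`**, **`recurrence_discr_scale`** (the translated ∕ scaled recurrences of N286).
CAVEATS.  Any field for the node statements; `ℝ` for the recurrence statements (N286 is real).  Nothing Ext-side.  New names only.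
-/

open Module Polynomial
open scoped Matrix Polynomial

namespace Summit.Ventures.HSemireg.Wedge.HankelOuter

/-! ## §1191. Affine behaviour of the discriminant -/

/-- **Translation invariance: `disc ∏_k (X − (x_k + s)) = disc ∏_k (X − x_k)`.** [Szegő (6.71.1); this file, §1191] -/
theorem discr_nodes_translate {K : Type*} [Field K] {t : ℕ} (x : Fin (t + 1) → K) (s : K) :
    (∏ k, (Polynomial.X - C (x k + s))).discr = (∏ k, (Polynomial.X - C (x k))).discr := by
  rw [discr_prod_X_sub_C K (fun k => x k + s), discr_prod_X_sub_C K x]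
  congr 1
  exact Finset.prod_congr rfl fun i _ => Finset.prod_congr rfl fun j _ => by ring

/-- `Σ_{i : Fin (t+1)} #Ioi(i) = t(t+1)∕2`. [bookkeeping; this file, §1191] -/
theorem sum_card_Ioi_fin (t : ℕ) : ∑ i : Fin (t + 1), (Finset.Ioi i).card = t * (t + 1) / 2 := by
  rw [Finset.sum_congr rfl fun i _ => Fin.card_Ioi i, Fin.sum_univ_eq_sum_range (fun i => t + 1 - 1 - i) (t + 1), Finset.sum_range_reflect (fun i => i) (t + 1)]
  have h := Finset.sum_range_id_mul_two (t + 1)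
  rw [Nat.add_sub_cancel] at h
  have h' : t * (t + 1) = (t + 1) * t := mul_comm _ _
  omega

/-- **Homogeneity: `disc ∏_k (X − c x_k) = c^{t(t+1)} · disc ∏_k (X − x_k)`** (`t+1` nodes). [Szegő (6.71.1); this file, §1191] -/
theorem discr_nodes_scale {K : Type*} [Field K] {t : ℕ} (x : Fin (t + 1) → K) (c : K) :
    (∏ k, (Polynomial.X - C (c * x k))).discr = c ^ (t * (t + 1)) * (∏ k, (Polynomial.X - C (x k))).discr := by
  rw [discr_prod_X_sub_C K (fun k => c * x k), discr_prod_X_sub_C K x]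
  have h : ∏ i : Fin (t + 1), ∏ j ∈ Finset.Ioi i, (c * x j - c * x i) = c ^ (t * (t + 1) / 2) * ∏ i : Fin (t + 1), ∏ j ∈ Finset.Ioi i, (x j - x i) := by
    rw [Finset.prod_congr rfl fun i _ => show ∏ j ∈ Finset.Ioi i, (c * x j - c * x i) = c ^ (Finset.Ioi i).card * ∏ j ∈ Finset.Ioi i, (x j - x i) by
      rw [← Finset.prod_const, ← Finset.prod_mul_distrib]; exact Finset.prod_congr rfl fun j _ => by ring,
      Finset.prod_mul_distrib, Finset.prod_pow_eq_pow_sum, sum_card_Ioi_fin]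
  rw [h, mul_pow, ← pow_mul, show t * (t + 1) / 2 * 2 = t * (t + 1) by obtain ⟨k, hk⟩ := Nat.even_mul_succ_self t; omega]

/-- **The translated recurrence `(a + s, b)` (N286) has the same discriminant.** [Szegő (6.71.1); this file, §1191] -/
theorem recurrence_discr_translate {q : ℕ → ℝ[X]} {a b : ℕ → ℝ} (hq0 : q 0 = 1) (hq1 : q 1 = Polynomial.X - C (a 0))
    (hrec : ∀ n, q (n + 2) = (Polynomial.X - C (a (n + 1))) * q (n + 1) - C (b (n + 1)) * q n) (s : ℝ) {t : ℕ} {x : Fin (t + 1) → ℝ}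
    (hxq : q (t + 1) = ∏ k, (Polynomial.X - C (x k))) : ((q (t + 1)).comp (Polynomial.X - C s)).discr = (q (t + 1)).discr := by
  obtain ⟨-, -, -, hfac⟩ := recurrence_translate_spec hq0 hq1 hrec s
  rw [hfac hxq, discr_nodes_translate, ← hxq]

/-- **The scaled recurrence `(c a, c² b)` (N286, `c ≠ 0`): `disc(c^{t+1} q_{t+1}(X∕c)) = c^{t(t+1)} disc(q_{t+1})`.** [Szegő (6.71.1); this file, §1191] -/
theorem recurrence_discr_scale {q : ℕ → ℝ[X]} {a b : ℕ → ℝ} (hq0 : q 0 = 1) (hq1 : q 1 = Polynomial.X - C (a 0))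
    (hrec : ∀ n, q (n + 2) = (Polynomial.X - C (a (n + 1))) * q (n + 1) - C (b (n + 1)) * q n) {c : ℝ} (hc : c ≠ 0) {t : ℕ} {x : Fin (t + 1) → ℝ}
    (hxq : q (t + 1) = ∏ k, (Polynomial.X - C (x k))) :
    (C (c ^ (t + 1)) * (q (t + 1)).comp (C c⁻¹ * Polynomial.X)).discr = c ^ (t * (t + 1)) * (q (t + 1)).discr := by
  obtain ⟨-, -, -, hfac⟩ := recurrence_scale_spec hq0 hq1 hrec hc
  rw [hfac hxq, discr_nodes_scale, ← hxq]

end Summit.Ventures.HSemireg.Wedge.HankelOuter
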